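import Literature.MathematicalPhysics.QuantumFieldTheory.Balaban1983to89.B7Prop5Flat
import Literature.MathematicalPhysics.QuantumFieldTheory.Balaban1983to89.B7Prop4Flat
import HarnessLib

/-!
# Line H (`BirthV10.stub_halvingStep`, stmt-QuantumFields-19200) — LEMMA B-al, `ℤᵈ` half of (B-al-1): ★★ ONE FLAT DOUBLE-BAR STEP IS `linQ` TO SECOND ORDER, WITH A
# LOCAL HYPOTHESIS (the field need only be small on the bonds of the block pair `B(c₋) ∪ B(c₊)`)

Cell `ym3-torus` (HUMAN RULING D-0037: YM₃ on T³ is ladder rung R3 — NOT d = 4, NOT infinite volume, NOT a mass gap, NOT the Clay problem), width seat `ym-ust-19200-w3` gen 10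
(LEAD-H ★w5-19200 g7 WORD 10 (2): LEMMA B-al ≡ (N1); SIGNATURE memo 67606d20 §2 (B-al-1), brick P2).  `--supports stmt-QuantumFields-19200 --as helper`; THEOREMS ONLY
(0 `def`, 0 `sorry`); count-neutral; nothing here claims B-al, `H42topCrossT`, (M2′), the stub, the crux or the gap.

WHY.  B-al's induction (B-al-2) runs level by level in LOCAL gauges (memo (F1)∕(F3)): at each coarse bond the field is small only on the two blocks the average reads.  Lit
✓`B7Prop4Flat.prop4_flat` (Prop. 4 of [Balaban1985Averaging] at the flat background, here at `k = 1`: `‖log V̿₁(c) − L·(Q₀B)_c‖ ≤ C₂(d)·(L·b)²`, `‖log V̿₁(c)‖ ≤ 2Lb`,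
`V̿₁(c) = exp(log V̿₁(c))`) asks for a GLOBAL bound `sup_b ‖B_b‖ ≤ b`; THIS FILE localises it by cutting `B` off outside the box `[q, q + (L−1)𝟙 + Le_κ]` and the one-step
locality of (89)∕(125) (lit ✓`B7Prop5Flat.dbavg_congr`, ✓`linQ_congr`, «an analytic function of the variables A_b, b ⊂ B(c₋) ∪ B(c₊)», p. 34).
* §1 `dbavgIter_one`, `linQIter_one` (the one-step readings of the iterates), `norm_cutoff_le` (the cut-off field is globally bounded);
* §2 ★★ `norm_mlog_dbavg_sub_linQ_le_local` — for `‖B(x,μ)‖ ≤ b` on the bonds of `B(c₋) ∪ B(c₊)` only (`c = ⟨q, q + Le_κ⟩`, `q = L·z`) and `L·b ≤ c₄(d)`: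
  `‖log V̿₁[e^{B}](c) − L·(Q₀B)_c‖ ≤ C₂(d)·(Lb)²`, `‖log V̿₁(c)‖ ≤ 2Lb`, `V̿₁(c) = exp(log V̿₁(c))`.
HONEST SCOPE.  Localisation bookkeeping over lit `B7Prop4Flat`∕`B7Prop5Flat`; the estimate is Prop. 4's; nothing of B-al's comparison or induction is here.

References: T. Bałaban, CMP **98** (1985) 17–51 [Balaban1985Averaging] (Prop. 4 (134)–(135) pp.38–39, (89) p.31, (121)–(125) p.36, p.34, p.24).
-/

set_option autoImplicit false

noncomputable section

open scoped BigOperators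

namespace Summit.QuantumFields.YangMills.Theorems.HalvingDbavgOneStepLocal

open Literature.MathematicalPhysics.QuantumFieldTheory.Balaban1983to89
open B7Prop1Explicit (Site e)
open B7Prop1Local (InBox AgreeOn bondHi)
open B7Prop3Flat (dbavg linQ expCfg)
open B7Prop4Flat (dbavgIter linQIter C2 c4 prop4_flat)
open B7Prop5Flat (dbavg_congr linQ_congr agreeOn_expCfg)
open MatrixLog (mlog)

variable {d : ℕ} {𝔸 : Type*} [NormedRing 𝔸] [NormedAlgebra ℂ 𝔸] [CompleteSpace 𝔸]

/-! ## §1 One-step readings and the cut-off field -/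

/-- `U̿₁^1 = V̿₁` read at the `L`-bond `⟨Lz, Lz + Le_κ⟩`. [cite: Balaban1985Averaging, (90) p.31] -/
theorem dbavgIter_one (L : ℕ) (V : Site d → Fin d → 𝔸ˣ) (z : Site d) (κ : Fin d) :
    dbavgIter L V 1 z κ = dbavg L V ((L : ℤ) • z) κ := rfl

omit [CompleteSpace 𝔸] in
/-- `Q₁(1)B = L·(Q₀B)` read at the `L`-bond `⟨Lz, Lz + Le_κ⟩`. [cite: Balaban1985Averaging, (127) p.37, (125) p.36] -/
theorem linQIter_one (L : ℕ) (B : Site d → Fin d → 𝔸) (z : Site d) (κ : Fin d) :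
    linQIter L B 1 z κ = linQ L B ((L : ℤ) • z) κ := rfl

omit [NormedAlgebra ℂ 𝔸] [CompleteSpace 𝔸] in
/-- The field cut off outside the box is globally bounded by the local bound. [folklore] -/
theorem norm_cutoff_le [∀ (x : Site d) (μ : Fin d) (lo hi : Site d), Decidable (InBox lo hi x ∧ InBox lo hi (x + e μ))]
    {lo hi : Site d} (B : Site d → Fin d → 𝔸) {b : ℝ} (hb : 0 ≤ b)
    (hB : ∀ x μ, InBox lo hi x → InBox lo hi (x + e μ) → ‖B x μ‖ ≤ b) (x : Site d) (μ : Fin d) :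
    ‖(if InBox lo hi x ∧ InBox lo hi (x + e μ) then B x μ else 0)‖ ≤ b := by
  split_ifs with h
  · exact hB x μ h.1 h.2
  · rw [norm_zero]; exact hb

/-! ## §2 Prop. 4 at `k = 1`, local hypothesis -/

/-- ★★ **ONE FLAT DOUBLE-BAR STEP IS `linQ` TO SECOND ORDER, LOCALLY** ([Balaban1985Averaging] Prop. 4 at `U₀ = 1`, `k = 1`, with the smallness of `B` asked only on the bonds of
`B(c₋) ∪ B(c₊) = [q, q + (L−1)𝟙 + Le_κ]`, `q = L·z`): `‖log V̿₁[e^{B}](c) − L·(Q₀B)_c‖ ≤ C₂(d)·(Lb)²`, `‖log V̿₁(c)‖ ≤ 2Lb`, and `V̿₁(c) = exp(log V̿₁(c))`.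
[cite: Balaban1985Averaging, Prop. 4 (134)-(135) pp.38-39, (131) p.38, (89) p.31, p.34, p.24] -/
theorem norm_mlog_dbavg_sub_linQ_le_local (L : ℕ) (hL : 2 ≤ L) (B : Site d → Fin d → 𝔸) (z : Site d) (κ : Fin d) {b : ℝ} (hb : 0 ≤ b)
    (hLb : (L : ℝ) * b ≤ c4 d)
    (hB : ∀ x μ, InBox ((L : ℤ) • z) (bondHi L ((L : ℤ) • z) κ) x → InBox ((L : ℤ) • z) (bondHi L ((L : ℤ) • z) κ) (x + e μ) → ‖B x μ‖ ≤ b) :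
    ‖mlog ((dbavg L (expCfg B) ((L : ℤ) • z) κ : 𝔸ˣ) : 𝔸) - linQ L B ((L : ℤ) • z) κ‖ ≤ C2 d * ((L : ℝ) * b) ^ 2 ∧
      ‖mlog ((dbavg L (expCfg B) ((L : ℤ) • z) κ : 𝔸ˣ) : 𝔸)‖ ≤ 2 * ((L : ℝ) * b) ∧
      ((dbavg L (expCfg B) ((L : ℤ) • z) κ : 𝔸ˣ) : 𝔸) = NormedSpace.exp (mlog ((dbavg L (expCfg B) ((L : ℤ) • z) κ : 𝔸ˣ) : 𝔸)) := by
  classical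
  have hL1 : 1 ≤ L := le_trans (by norm_num) hL
  set q : Site d := (L : ℤ) • z with hq
  -- the cut-off field: equal to `B` on the box, `0` outside, globally bounded by `b`
  set B' : Site d → Fin d → 𝔸 := fun x μ => if InBox q (bondHi L q κ) x ∧ InBox q (bondHi L q κ) (x + e μ) then B x μ else 0 with hB'
  have hB'b : ∀ x μ, ‖B' x μ‖ ≤ b := fun x μ => norm_cutoff_le B hb hB x μ
  have hagree : AgreeOn q (bondHi L q κ) B' B := fun x μ hx hxμ => by
    simp only [hB', if_pos (And.intro hx hxμ)]
  -- Prop. 4 at `k = 1` for the cut-off field, then locality of (89) and (125)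
  have h4 := prop4_flat L hL B' hb hB'b 1 le_rfl (by rwa [pow_one]) z κ
  rw [dbavgIter_one, linQIter_one, pow_one, dbavg_congr L hL1 q κ (agreeOn_expCfg hagree), linQ_congr L q κ hagree] at h4
  exact h4

end Summit.QuantumFields.YangMills.Theorems.HalvingDbavgOneStepLocal

end
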